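import Literature.Barriers.RiemannHypothesis.EpsteinZetaThetaDecomposition
import Mathlib.MeasureTheory.Integral.ExpDecay
import HarnessLib

/-!
# The constant terms of the Epstein zeta function: `Λ_z(s) = 2y^s Λ(2s) + 2y^{1−s} Λ(2−2s) + E_z(s)` with `E_z` entire, symmetric and exponentially small

Proof file (five auxiliary definitions with bodies, everything else proved) in the series attached to
`Literature/Barriers/RiemannHypothesis/EpsteinZetaRealZeros.lean` (barrier `EpsteinZetaRealZeros =
BatemanGrosswald1964_realZero ∧ Stark1967_thm1`). It builds on `EpsteinZetaThetaDecomposition.lean`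
(`Literature.Barriers.RiemannHypothesis.thetaQ_decomposition`:
`Θ_z(t) = ϑ(t/y) + √(y/t)(ϑ(ty) − 1) + 4√(y/t) Σ_{m,k≥1} e^{−πy(tm²+k²/t)} cos(2πxmk)`) and is the
input "the Bessel part is negligible" of the (planned) proof of Stark's Theorem 1
(`EpsteinZetaStarkSetup.lean`, `EpsteinZetaStarkArg.lean`, `EpsteinZetaStark*.lean`). The
Chowla–Selberg formula ITSELF (Bateman–Grosswald's Theorem 1 with the `K`-Bessel series `H`) is the
subject of `EpsteinZetaChowlaSelberg*.lean` (`Literature.Barriers.RiemannHypothesis.chowlaSelberg_formula`,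
`BatemanGrosswald1964_thm1_holds`); here only the MELLIN-side statement needed for contour
arguments is proved, for the completed function `Λ_z(s) = ∫₀^∞ (Θ_z(t) − 1) t^{s−1} dt` of the lattice
`ℤz + ℤ` (`Literature.NumberTheory.Automorphic.thetaFEPair`):

  `Λ_z(s) = 2 y^s Λ(2s) + 2 y^{1−s} Λ(2 − 2s) + E_z(s)`      (`y = Im z`, `Λ = completedRiemannZeta`)

(`Literature.Barriers.RiemannHypothesis.Λ_eq_constantTerm_add_besselPart`, all `s ∉ {0, ½, 1}`), where
`E_z` is ENTIRE, `E_z(1 − s) = E_z(s)`, and **`|E_z(σ + it)| ≤ 48 √y e^{−1.4πy}` for `−1 ≤ σ ≤ 2`,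
`y ≥ 1`** (`Literature.Barriers.RiemannHypothesis.norm_epsteinBesselPart_le`). In Bateman–Grosswald's
notation (Acta Arith. 9 (1964), Theorem 1, (3)–(5)) `E_z` corresponds to `2k^{½}H(s)` for the form
with Stark's parameter `k = y` (`Λ_z(s) = 2(k/π)^sΓ(s)a^sZ(s)`), and in Stark's (Mathematika 14
(1967), (9)–(12): `α = f(s) + f(1−s) + g(s)`) to `2g(s)`; this identification with the tree's
`Literature.Barriers.RiemannHypothesis.bgH` is NOT proved here (Stark's argument only needs that the
third term is entire, symmetric and exponentially small, which is what is proved).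

## The proof (Riemann's second proof, termwise)

From `thetaQ_decomposition`, `Θ_z(t) − 1 = [ϑ(t/y) − 1] + √(y/t)[ϑ(yt) − 1] + R_z(t)` with
`R_z(t) = 4√(y/t) Σ_{m,k≥1} e^{−πy(tm²+k²/t)} cos(2πxmk)` (`Literature.Barriers.RiemannHypothesis.thetaRemainder_eq_cross`),
so `|R_z(t)| ≤ √(y/t)(ϑ(yt) − 1)(ϑ(y/t) − 1)` (`|cos| ≤ 1`, `ϑ − 1 = 2Σ_{n≥1}e^{−πn²u}`;
`Literature.Barriers.RiemannHypothesis.norm_thetaRemainder_le`) and `R_z(1/t) = t R_z(t)`. The Mellin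
transforms of the first two pieces are `y^s Λ^H(s) = 2y^sΛ(2s)` and
`y^{1−s}Λ^H(s − ½) = 2y^{1−s}Λ(2s − 1) = 2y^{1−s}Λ(2 − 2s)` for `Re s > 1` (Mathlib's
`WeakFEPair.hasMellin` for the Hurwitz pair `hurwitzEvenFEPair 0`, i.e. `∫₀^∞(ϑ − 1)t^{s−1}dt = 2Λ(2s)`,
`Re s > ½`); the third is `E_z(s) := ∫₁^∞ (t^{s−1} + t^{−s}) R_z(t) dt` (Riemann's trick), which is
entire and symmetric by construction and equals `∫₀^∞ R_z t^{s−1}` whenever the latter converges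
absolutely. The bound: for `t ≥ 1`, `y ≥ 1`, `ϑ(yt) − 1 ≤ 3e^{−πyt}`, `ϑ(y/t) − 1 ≤ 2e^{−πy/t}(1 + t/(πy))`,
`t + 1/t ≥ 7/5 + t/2`, so `R_z ≤ 6√y (1+t) e^{−1.4πy} e^{−πt/2}` and
`|E_z| ≤ 2·12√y e^{−1.4πy} ∫₀^∞ t²e^{−t} = 48√y e^{−1.4πy}`.
The identity is extended from `Re s > 1` to `s ∉ {0, ½, 1}` by the identity theorem.

## References

* [BatemanGrosswald1964] P. T. Bateman, E. Grosswald, *On Epstein's zeta function*, Acta Arith. 9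
  (1964) 365–373, Theorem 1 ((3)–(5)) and Theorem 2 ((7)–(8)) (read from the held scan).
* [Stark1967EpsteinZeros] H. M. Stark, *On the zeros of Epstein's zeta function*, Mathematika 14
  (1967) 47–55, §2 (9)–(12).
* [MontgomeryVaughan2007] §10.1 Exercise 25 (the theta-function continuation).
-/

noncomputable section

open Complex Filter Topology MeasureTheory Set HurwitzZeta Asymptotics

open scoped UpperHalfPlane Real

namespace Literature.Barriers.RiemannHypothesis

open Literature.NumberTheory.Automorphic
open Literature.NumberTheory.LFunctions.RealZeros (one_le_evenKernel_zero)

/-! ## More on `ϑ = evenKernel 0` -/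

/-- `ϑ(u) − 1 ≤ 3 e^{−πu}` for `u ≥ 1` (`2e^{−πu}/(1 − e^{−π})`, `e^{−π} ≤ 1/4`). [folklore] -/
theorem evenKernel_zero_sub_one_le_three_mul {u : ℝ} (hu : 1 ≤ u) :
    evenKernel 0 u - 1 ≤ 3 * Real.exp (-Real.pi * u) := by
  have h := evenKernel_zero_sub_one_le (by linarith : 0 < u)
  have hq : Real.exp (-Real.pi * u) ≤ 1 / 4 := by
    refine le_trans (Real.exp_le_exp.2 ?_) exp_neg_pi_le
    nlinarith [Real.pi_pos]
  have hq0 := Real.exp_pos (-Real.pi * u)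
  rw [le_div_iff₀ (by linarith)] at h
  nlinarith

/-- `ϑ(u) − 1 ≤ 2 e^{−πu} (1 + 1/(πu))` for `u > 0` (`1/(1 − e^{−v}) ≤ 1 + 1/v` from `1 + v ≤ e^v`).
[folklore] -/
theorem evenKernel_zero_sub_one_le_of_pos {u : ℝ} (hu : 0 < u) :
    evenKernel 0 u - 1 ≤ 2 * Real.exp (-Real.pi * u) * (1 + 1 / (Real.pi * u)) := by
  have h := evenKernel_zero_sub_one_le hu
  set v : ℝ := Real.pi * u with hv
  have hv0 : 0 < v := by positivity
  set q : ℝ := Real.exp (-Real.pi * u) with hq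
  have hq0 : 0 < q := Real.exp_pos _
  have hq1 : q < 1 := by
    rw [hq, Real.exp_lt_one_iff]; nlinarith [Real.pi_pos]
  -- `q (1 + v) ≤ 1`
  have hkey : q * (1 + v) ≤ 1 := by
    have h1 : 1 + v ≤ Real.exp v := by linarith [Real.add_one_le_exp v]
    have h2 : q * Real.exp v = 1 := by
      rw [hq, hv, ← Real.exp_add]; simp
    nlinarith
  rw [le_div_iff₀ (by linarith)] at h
  -- want: `ϑ - 1 ≤ 2 q (1 + 1/v)`; have `(ϑ - 1)(1 - q) ≤ 2q`
  have hle : 2 * q ≤ 2 * q * (1 + 1 / v) * (1 - q) := by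
    have : 1 ≤ (1 + 1 / v) * (1 - q) := by
      rw [show (1 + 1 / v) * (1 - q) = 1 + (1 - q * (1 + v)) / v by field_simp; ring]
      have : 0 ≤ (1 - q * (1 + v)) / v := div_nonneg (by linarith) hv0.le
      linarith
    nlinarith
  have h1q : 0 < 1 - q := by linarith
  exact le_of_mul_le_mul_right (h.trans hle) h1q

/-- `ϑ` is continuous on `(0, ∞)` composed with `t ↦ c t`, `c > 0`. [folklore] -/
theorem continuousOn_evenKernel_comp_mul {c : ℝ} (hc : 0 < c) :
    ContinuousOn (fun t : ℝ ↦ evenKernel 0 (c * t)) (Ioi 0) :=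
  (continuousOn_evenKernel 0).comp (continuous_const.mul continuous_id).continuousOn
    fun _ ht ↦ mul_pos hc ht

/-! ## The remainder `R_z` of the theta series and its majorant -/

/-- **The remainder of the theta series after its two constant terms**:
`R_z(t) = Θ_z(t) − ϑ(t/y) − √(y/t)(ϑ(yt) − 1)` (`y = Im z`, `ϑ = Σ_n e^{−πn²u}`), i.e.
`Θ_z − 1 = [ϑ(t/y) − 1] + √(y/t)[ϑ(yt) − 1] + R_z`; for `t > 0` it is the cosine double series
`4√(y/t) Σ_{m,k≥1} e^{−πy(tm²+k²/t)} cos(2πxmk)` of `Literature.Barriers.RiemannHypothesis.thetaQ_decomposition`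
(`thetaRemainder_eq_cross`), whose Mellin transform is (morally) Bateman–Grosswald's `K`-Bessel series
`2k^{½}H(s)`. [cite: BatemanGrosswald1964, §3 (15)–(18)] -/
def thetaRemainder (z : ℍ) (t : ℝ) : ℂ :=
  (thetaQ z t : ℂ) - (evenKernel 0 (t / z.im) : ℂ) -
    (Real.sqrt (z.im / t) : ℂ) * ((evenKernel 0 (z.im * t) : ℂ) - 1)

/-- The majorant `R̄_z(t) = √(y/t) (ϑ(yt) − 1)(ϑ(y/t) − 1) ≥ |R_z(t)|`. [folklore] -/
def thetaRemainderBound (z : ℍ) (t : ℝ) : ℝ :=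
  Real.sqrt (z.im / t) * (evenKernel 0 (z.im * t) - 1) * (evenKernel 0 (z.im / t) - 1)

/-- Unfolding of `thetaRemainder`. [folklore] -/
theorem thetaRemainder_def (z : ℍ) (t : ℝ) : thetaRemainder z t =
    (thetaQ z t : ℂ) - (evenKernel 0 (t / z.im) : ℂ) -
      (Real.sqrt (z.im / t) : ℂ) * ((evenKernel 0 (z.im * t) : ℂ) - 1) := rfl

/-- `R̄_z(t) ≥ 0` for `t > 0`. [folklore] -/
theorem thetaRemainderBound_nonneg (z : ℍ) {t : ℝ} (ht : 0 < t) : 0 ≤ thetaRemainderBound z t := by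
  have hy := z.im_pos
  unfold thetaRemainderBound
  have h1 := one_le_evenKernel_zero (mul_pos hy ht)
  have h2 := one_le_evenKernel_zero (div_pos hy ht)
  have : 0 ≤ Real.sqrt (z.im / t) := Real.sqrt_nonneg _
  apply mul_nonneg (mul_nonneg this (by linarith)) (by linarith)

/-! ### The remainder as the cosine double series -/

/-- **The remainder is the cosine double series of `thetaQ_decomposition`**:
`R_z(t) = 4√(y/t) Σ_{m,k≥1} e^{−πy(tm² + k²/t)} cos(2πxmk)` (`t > 0`), in particular real.
[cite: BatemanGrosswald1964, §3 (15)–(18)] -/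
theorem thetaRemainder_eq_cross (z : ℍ) {t : ℝ} (ht : 0 < t) :
    thetaRemainder z t = ((4 * Real.sqrt (z.im / t) * ∑' p : ℕ × ℕ,
        Real.exp (-Real.pi * z.im * (t * ((p.1 : ℝ) + 1) ^ 2 + ((p.2 : ℝ) + 1) ^ 2 / t)) *
          Real.cos (2 * Real.pi * z.re * ((p.1 : ℝ) + 1) * ((p.2 : ℝ) + 1)) : ℝ) : ℂ) := by
  rw [thetaRemainder_def, thetaQ_decomposition z ht, mul_comm t z.im]
  push_cast
  ring

/-- **`|R_z(t)| ≤ R̄_z(t) = √(y/t)(ϑ(yt) − 1)(ϑ(y/t) − 1)`** for `t > 0`: in the cosine double series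
bound `|cos| ≤ 1`, and the remaining double series factors as `(Σ_{m≥1}e^{−πytm²})(Σ_{k≥1}e^{−πyk²/t})
= ¼(ϑ(yt) − 1)(ϑ(y/t) − 1)`. [folklore] -/
theorem norm_thetaRemainder_le (z : ℍ) {t : ℝ} (ht : 0 < t) :
    ‖thetaRemainder z t‖ ≤ thetaRemainderBound z t := by
  have hy := z.im_pos
  set y := z.im with hydef
  set x := z.re with hxdef
  -- the two one-variable Gaussian families over `ℕ` (shifted by one)
  set a : ℕ → ℝ := fun m ↦ Real.exp (-(Real.pi * y * t) * ((m : ℝ) + 1) ^ 2) with ha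
  set b : ℕ → ℝ := fun k ↦ Real.exp (-(Real.pi * y / t) * ((k : ℝ) + 1) ^ 2) with hb
  have hsa : HasSum (fun m : ℕ ↦ 2 * a m) (evenKernel 0 (y * t) - 1) := by
    have := hasSum_evenKernel_zero_sub_one (mul_pos hy ht)
    refine this.congr_fun fun m ↦ ?_
    simp only [ha]; congr 1; ring
  have hsb : HasSum (fun k : ℕ ↦ 2 * b k) (evenKernel 0 (y / t) - 1) := by
    have := hasSum_evenKernel_zero_sub_one (div_pos hy ht)
    refine this.congr_fun fun k ↦ ?_
    simp only [hb]; congr 1; ring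
  have hsa' : Summable a := by
    have := hsa.summable.mul_left (1 / 2)
    exact this.congr fun m ↦ by ring
  have hsb' : Summable b := by
    have := hsb.summable.mul_left (1 / 2)
    exact this.congr fun k ↦ by ring
  have hprod : Summable fun p : ℕ × ℕ ↦ a p.1 * b p.2 :=
    hsa'.mul_of_nonneg hsb' (fun _ ↦ (Real.exp_pos _).le) (fun _ ↦ (Real.exp_pos _).le)
  -- termwise: `|e^{...} cos(...)| ≤ a_m b_k`
  set c : ℕ × ℕ → ℝ := fun p ↦ Real.exp (-Real.pi * y * (t * ((p.1 : ℝ) + 1) ^ 2 + ((p.2 : ℝ) + 1) ^ 2 / t)) *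
    Real.cos (2 * Real.pi * x * ((p.1 : ℝ) + 1) * ((p.2 : ℝ) + 1)) with hc
  have hterm : ∀ p : ℕ × ℕ, ‖c p‖ ≤ a p.1 * b p.2 := by
    intro p
    simp only [hc, ha, hb]
    rw [Real.norm_eq_abs, abs_mul, Real.abs_exp, ← Real.exp_add]
    refine le_trans (mul_le_of_le_one_right (Real.exp_pos _).le (Real.abs_cos_le_one _)) (le_of_eq ?_)
    congr 1
    field_simp
    ring
  have hcs : Summable fun p : ℕ × ℕ ↦ ‖c p‖ := Summable.of_nonneg_of_le (fun _ ↦ norm_nonneg _) hterm hprod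
  have hval := thetaRemainder_eq_cross z ht
  rw [← hydef, ← hxdef] at hval
  rw [hval, Complex.norm_real, Real.norm_eq_abs, abs_mul, abs_mul, abs_of_pos (by norm_num : (0 : ℝ) < 4),
    abs_of_nonneg (Real.sqrt_nonneg _)]
  unfold thetaRemainderBound
  rw [← hydef]
  have htsum : |∑' p : ℕ × ℕ, c p| ≤ (∑' m, a m) * ∑' k, b k := by
    calc |∑' p : ℕ × ℕ, c p| = ‖∑' p : ℕ × ℕ, c p‖ := (Real.norm_eq_abs _).symm
      _ ≤ ∑' p : ℕ × ℕ, ‖c p‖ := norm_tsum_le_tsum_norm hcs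
      _ ≤ ∑' p : ℕ × ℕ, a p.1 * b p.2 := hcs.tsum_le_tsum hterm hprod
      _ = (∑' m, a m) * ∑' k, b k := (hsa'.tsum_mul_tsum hsb' hprod).symm
  have hA : ∑' m, a m = (evenKernel 0 (y * t) - 1) / 2 := by
    have := hsa.tsum_eq; rw [tsum_mul_left] at this; linarith
  have hB : ∑' k, b k = (evenKernel 0 (y / t) - 1) / 2 := by
    have := hsb.tsum_eq; rw [tsum_mul_left] at this; linarith
  rw [hA, hB] at htsum
  have hsq : 0 ≤ Real.sqrt (y / t) := Real.sqrt_nonneg _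
  calc 4 * Real.sqrt (y / t) * |∑' p : ℕ × ℕ, c p|
      ≤ 4 * Real.sqrt (y / t) * ((evenKernel 0 (y * t) - 1) / 2 * ((evenKernel 0 (y / t) - 1) / 2)) := by
        gcongr
    _ = Real.sqrt (y / t) * (evenKernel 0 (y * t) - 1) * (evenKernel 0 (y / t) - 1) := by ring

/-- **The functional equation of the remainder**: `R_z(1/t) = t R_z(t)` (`t > 0`), inherited from
`Θ_z(1/t) = tΘ_z(t)` and `ϑ(1/u) = √u ϑ(u)`. [folklore] -/
theorem thetaRemainder_inv (z : ℍ) {t : ℝ} (ht : 0 < t) :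
    thetaRemainder z t⁻¹ = t * thetaRemainder z t := by
  have hy := z.im_pos
  simp only [thetaRemainder_def]
  rw [← one_div, thetaQ_functional_equation z ht]
  -- `ϑ((1/t)/y) = ϑ(1/(ty)) = √(ty) ϑ(ty)` and `ϑ(y/(1/t)) = ϑ(yt)`, `ϑ(t/y) = √(y/t) ϑ(y/t)`
  have e1 : evenKernel 0 (1 / t / z.im) = Real.sqrt (z.im * t) * evenKernel 0 (z.im * t) := by
    rw [← sqrt_mul_evenKernel_zero (1 / t) z.im, show z.im / (1 / t) = z.im * t by field_simp]
  have e2 : evenKernel 0 (t / z.im) = Real.sqrt (z.im / t) * evenKernel 0 (z.im / t) :=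
    (sqrt_mul_evenKernel_zero t z.im).symm
  have e4 : Real.sqrt (z.im / (1 / t)) = t * Real.sqrt (z.im / t) := sqrt_mul_eq z.im ht
  have e5 : Real.sqrt (z.im * t) = t * Real.sqrt (z.im / t) := by
    rw [← e4]; congr 1; field_simp
  have e6 : z.im * (1 / t) = z.im / t := by ring
  rw [e1, e2, e4, e6, e5]
  push_cast
  ring

/-- Continuity of `R_z` on `(0, ∞)`. [folklore] -/
theorem continuousOn_thetaRemainder (z : ℍ) : ContinuousOn (thetaRemainder z) (Ioi 0) := by
  have hy := z.im_pos
  unfold thetaRemainder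
  refine ((Complex.continuous_ofReal.comp_continuousOn (continuousOn_thetaQ z)).sub ?_).sub ?_
  · refine Complex.continuous_ofReal.comp_continuousOn ?_
    have := continuousOn_evenKernel_comp_mul (c := z.im⁻¹) (inv_pos.2 hy)
    refine this.congr fun t _ ↦ ?_
    simp [div_eq_inv_mul]
  · refine ContinuousOn.mul ?_ ?_
    · refine Complex.continuous_ofReal.comp_continuousOn ?_
      exact (Real.continuous_sqrt.comp_continuousOn
        ((continuousOn_const.div continuousOn_id fun t ht ↦ (ne_of_gt ht))))
    · refine (Complex.continuous_ofReal.comp_continuousOn ?_).sub continuousOn_const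
      exact continuousOn_evenKernel_comp_mul hy

/-! ### The majorant on `t ≥ 1` -/

/-- `t + 1/t ≥ 7/5 + t/2` for `t > 0`. [folklore] -/
theorem seven_fifths_add_half_le {t : ℝ} (ht : 0 < t) : 7 / 5 + t / 2 ≤ t + 1 / t := by
  rw [div_add_div _ _ (by norm_num : (5 : ℝ) ≠ 0) two_ne_zero, div_le_iff₀ (by norm_num : (0 : ℝ) < 5 * 2)]
  have h1 : 1 / t * (5 * 2) = 10 / t := by ring
  have key : 0 ≤ (t - 7 / 5) ^ 2 / 2 + 1 / 50 := by positivity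
  have ht' : t * (1 / t) = 1 := by field_simp
  nlinarith [ht', key, sq_nonneg (t - 7 / 5)]

/-- **The majorant bound**: for `y ≥ 1`, `t ≥ 1`, `R̄_z(t) ≤ 6√y (1 + t) e^{−(7/5)πy} e^{−πt/2}`.
[cite: BatemanGrosswald1964, Theorem 2 (8) and §3 (19)] -/
theorem thetaRemainderBound_le (z : ℍ) (hy : 1 ≤ z.im) {t : ℝ} (ht : 1 ≤ t) :
    thetaRemainderBound z t ≤
      6 * Real.sqrt z.im * (1 + t) * Real.exp (-(7 / 5) * Real.pi * z.im) * Real.exp (-(Real.pi * t) / 2) := by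
  have hπ := Real.pi_pos
  have hπ3 := Real.pi_gt_three
  set y := z.im with hydef
  have hy0 : 0 < y := by linarith
  have ht0 : 0 < t := by linarith
  unfold thetaRemainderBound
  rw [← hydef]
  -- the three factors
  have hsqrt : Real.sqrt (y / t) ≤ Real.sqrt y := Real.sqrt_le_sqrt (div_le_self hy0.le ht)
  have hA : evenKernel 0 (y * t) - 1 ≤ 3 * Real.exp (-Real.pi * (y * t)) :=
    evenKernel_zero_sub_one_le_three_mul (by nlinarith)
  have hB : evenKernel 0 (y / t) - 1 ≤ 2 * Real.exp (-Real.pi * (y / t)) * (1 + t) := by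
    refine (evenKernel_zero_sub_one_le_of_pos (div_pos hy0 ht0)).trans ?_
    have : 1 / (Real.pi * (y / t)) ≤ t := by
      rw [div_le_iff₀ (by positivity)]
      have : 1 ≤ Real.pi * y := by nlinarith
      calc (1 : ℝ) ≤ Real.pi * y := this
        _ = t * (Real.pi * (y / t)) := by field_simp
    have h0 : 0 ≤ 2 * Real.exp (-Real.pi * (y / t)) := by positivity
    nlinarith
  have hA0 : 0 ≤ evenKernel 0 (y * t) - 1 := by linarith [one_le_evenKernel_zero (mul_pos hy0 ht0)]
  have hB0 : 0 ≤ evenKernel 0 (y / t) - 1 := by linarith [one_le_evenKernel_zero (div_pos hy0 ht0)]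
  -- the exponentials: `e^{-π y t} e^{-π y/t} ≤ e^{-(7/5)π y} e^{-π t/2}`
  have hexp : Real.exp (-Real.pi * (y * t)) * Real.exp (-Real.pi * (y / t)) ≤
      Real.exp (-(7 / 5) * Real.pi * y) * Real.exp (-(Real.pi * t) / 2) := by
    rw [← Real.exp_add, ← Real.exp_add, Real.exp_le_exp]
    have hst := seven_fifths_add_half_le ht0
    have e : -Real.pi * (y * t) + -Real.pi * (y / t) = -(Real.pi * y) * (t + 1 / t) := by ring
    rw [e]
    have h1 : -(Real.pi * y) * (t + 1 / t) ≤ -(Real.pi * y) * (7 / 5 + t / 2) :=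
      mul_le_mul_of_nonpos_left hst (by nlinarith)
    refine h1.trans ?_
    have : Real.pi * 1 * t ≤ Real.pi * y * t := by gcongr
    nlinarith
  calc Real.sqrt (y / t) * (evenKernel 0 (y * t) - 1) * (evenKernel 0 (y / t) - 1)
      ≤ Real.sqrt y * (3 * Real.exp (-Real.pi * (y * t))) * (2 * Real.exp (-Real.pi * (y / t)) * (1 + t)) := by
        gcongr
    _ = 6 * Real.sqrt y * (1 + t) * (Real.exp (-Real.pi * (y * t)) * Real.exp (-Real.pi * (y / t))) := by ring
    _ ≤ 6 * Real.sqrt y * (1 + t) * (Real.exp (-(7 / 5) * Real.pi * y) * Real.exp (-(Real.pi * t) / 2)) := by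
        gcongr
    _ = _ := by ring

/-- The working bound `‖R_z(t)‖ ≤ 12 √y e^{−(7/5)πy} · t e^{−t}` for `t ≥ 1`, `y ≥ 1`
(`1 + t ≤ 2t`, `e^{−πt/2} ≤ e^{−t}`). [folklore] -/
theorem norm_thetaRemainder_le_of_one_le (z : ℍ) (hy : 1 ≤ z.im) {t : ℝ} (ht : 1 ≤ t) :
    ‖thetaRemainder z t‖ ≤
      12 * Real.sqrt z.im * Real.exp (-(7 / 5) * Real.pi * z.im) * (t * Real.exp (-t)) := by
  have ht0 : 0 < t := by linarith
  refine (norm_thetaRemainder_le z ht0).trans ((thetaRemainderBound_le z hy ht).trans ?_)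
  have h1 : Real.exp (-(Real.pi * t) / 2) ≤ Real.exp (-t) := Real.exp_le_exp.2 (by nlinarith [Real.pi_gt_three])
  have h2 : 1 + t ≤ 2 * t := by linarith
  have h0 : 0 ≤ 6 * Real.sqrt z.im := by positivity
  have hE := Real.exp_pos (-(7 / 5) * Real.pi * z.im)
  calc 6 * Real.sqrt z.im * (1 + t) * Real.exp (-(7 / 5) * Real.pi * z.im) * Real.exp (-(Real.pi * t) / 2)
      ≤ 6 * Real.sqrt z.im * (2 * t) * Real.exp (-(7 / 5) * Real.pi * z.im) * Real.exp (-t) := by gcongr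
    _ = 12 * Real.sqrt z.im * Real.exp (-(7 / 5) * Real.pi * z.im) * (t * Real.exp (-t)) := by ring

/-! ## The Bessel part `E_z(s) = ∫₁^∞ (t^{s−1} + t^{−s}) R_z(t) dt` -/

/-- The truncated remainder `𝟙_{(1,∞)} R_z`. [folklore] -/
def thetaRemainderTop (z : ℍ) : ℝ → ℂ := (Ioi 1).indicator (thetaRemainder z)

/-- **The Bessel part of the completed Epstein zeta function** (the Mellin transform of the remainder,
written by Riemann's trick as an integral over `(1, ∞)`):
`E_z(s) = ∫₁^∞ R_z(t) t^{s−1} dt + ∫₁^∞ R_z(t) t^{−s} dt`. It plays the role of Bateman–Grosswald's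
`2k^{½}H(s)` (`k = y`; Theorem 1 (3)–(5)) and of Stark's `2g(s)` ((9)–(12)); the identification with
the tree's `bgH` (`EpsteinZetaBatemanGrosswald.lean`) is not proved in this file — only entirety,
symmetry and smallness, which is what contour arguments use. [cite: BatemanGrosswald1964, Theorem 1 (3)–(5)] -/
def epsteinBesselPart (z : ℍ) (s : ℂ) : ℂ :=
  mellin (thetaRemainderTop z) s + mellin (thetaRemainderTop z) (1 - s)

/-- `E_z(1 − s) = E_z(s)` (by construction; Bateman–Grosswald's `H(s) = H(1 − s)`, Stark's (12)).
[cite: BatemanGrosswald1964, Theorem 1] -/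
theorem epsteinBesselPart_one_sub (z : ℍ) (s : ℂ) :
    epsteinBesselPart z (1 - s) = epsteinBesselPart z s := by
  unfold epsteinBesselPart; rw [sub_sub_cancel, add_comm]

/-- The truncated remainder vanishes near `0`. [folklore] -/
theorem thetaRemainderTop_eventuallyEq_zero (z : ℍ) :
    thetaRemainderTop z =ᶠ[𝓝[>] 0] 0 := by
  have : Ioo (0 : ℝ) 1 ∈ 𝓝[>] (0 : ℝ) := Ioo_mem_nhdsGT one_pos
  filter_upwards [this] with t ht
  simp only [thetaRemainderTop, Pi.zero_apply]
  rw [Set.indicator_of_notMem]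
  simp only [mem_Ioi, not_lt]
  exact ht.2.le

/-- The truncated remainder is `O(e^{−t/2})` at `∞` (for `y ≥ 1`). [folklore] -/
theorem thetaRemainderTop_isBigO_exp (z : ℍ) (hy : 1 ≤ z.im) :
    thetaRemainderTop z =O[atTop] fun t ↦ Real.exp (-(1 / 2) * t) := by
  set C : ℝ := 12 * Real.sqrt z.im * Real.exp (-(7 / 5) * Real.pi * z.im) with hC
  have hC0 : 0 ≤ C := by positivity
  refine IsBigO.of_bound (C * 2) ?_
  filter_upwards [eventually_gt_atTop (1 : ℝ)] with t ht
  have hval : thetaRemainderTop z t = thetaRemainder z t :=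
    Set.indicator_of_mem (mem_Ioi.2 ht) _
  rw [hval, Real.norm_of_nonneg (Real.exp_nonneg _)]
  refine (norm_thetaRemainder_le_of_one_le z hy ht.le).trans ?_
  -- `t e^{-t} ≤ 2 e^{-t/2}` since `t ≤ 2 e^{t/2}`
  have h1 : t * Real.exp (-t) ≤ 2 * Real.exp (-(1 / 2) * t) := by
    have hq : t / 2 + 1 ≤ Real.exp (t / 2) := Real.add_one_le_exp _
    have e : Real.exp (-t) = Real.exp (-(1 / 2) * t) * (Real.exp (t / 2))⁻¹ := by
      rw [← Real.exp_neg, ← Real.exp_add]; congr 1; ring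
    rw [e, ← mul_assoc, mul_inv_le_iff₀ (Real.exp_pos _)]
    have hE := Real.exp_pos (-(1 / 2) * t)
    nlinarith
  calc C * (t * Real.exp (-t)) ≤ C * (2 * Real.exp (-(1 / 2) * t)) := by gcongr
    _ = C * 2 * Real.exp (-(1 / 2) * t) := by ring

/-- The truncated remainder is locally integrable on `(0, ∞)`. [folklore] -/
theorem locallyIntegrableOn_thetaRemainderTop (z : ℍ) :
    LocallyIntegrableOn (thetaRemainderTop z) (Ioi 0) := by
  rw [locallyIntegrableOn_iff isOpen_Ioi.isLocallyClosed]
  intro K hK hKc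
  have hcont : ContinuousOn (thetaRemainder z) K := (continuousOn_thetaRemainder z).mono hK
  exact (hcont.integrableOn_compact hKc).indicator measurableSet_Ioi

/-- The truncated remainder is `O(t^{−b})` at `0⁺` for every `b` (it vanishes there). [folklore] -/
theorem thetaRemainderTop_isBigO_nhds_zero (z : ℍ) (b : ℝ) :
    thetaRemainderTop z =O[𝓝[>] 0] fun t : ℝ ↦ t ^ (-b) :=
  (isBigO_zero _ _).congr' (thetaRemainderTop_eventuallyEq_zero z).symm EventuallyEq.rfl

/-- The Mellin transform of the truncated remainder converges at every `s` (`y ≥ 1`). [folklore] -/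
theorem mellinConvergent_thetaRemainderTop (z : ℍ) (hy : 1 ≤ z.im) (s : ℂ) :
    MellinConvergent (thetaRemainderTop z) s :=
  mellinConvergent_of_isBigO_rpow_exp (a := 1 / 2) (b := s.re - 1) (by norm_num)
    (locallyIntegrableOn_thetaRemainderTop z) (thetaRemainderTop_isBigO_exp z hy)
    (thetaRemainderTop_isBigO_nhds_zero z _) (by linarith)

/-- The Mellin transform of the truncated remainder is entire (`y ≥ 1`). [folklore] -/
theorem differentiable_mellin_thetaRemainderTop (z : ℍ) (hy : 1 ≤ z.im) :
    Differentiable ℂ (mellin (thetaRemainderTop z)) := fun s ↦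
  mellin_differentiableAt_of_isBigO_rpow_exp (a := 1 / 2) (b := s.re - 1) (by norm_num)
    (locallyIntegrableOn_thetaRemainderTop z) (thetaRemainderTop_isBigO_exp z hy)
    (thetaRemainderTop_isBigO_nhds_zero z _) (by linarith)

/-- **`E_z` is entire** (Bateman–Grosswald: "`H(s)` is an entire function of `s`"; Stark (12)).
[cite: BatemanGrosswald1964, Theorem 1] -/
theorem differentiable_epsteinBesselPart (z : ℍ) (hy : 1 ≤ z.im) :
    Differentiable ℂ (epsteinBesselPart z) := by
  unfold epsteinBesselPart
  exact (differentiable_mellin_thetaRemainderTop z hy).add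
    ((differentiable_mellin_thetaRemainderTop z hy).comp (differentiable_const _ |>.sub differentiable_id))

/-- `∫₀^∞ e^{−t} t² dt = 2`, in the form used below. [folklore] -/
theorem integral_exp_neg_mul_sq : ∫ t in Ioi (0 : ℝ), Real.exp (-t) * t ^ 2 = 2 := by
  have h := Real.Gamma_eq_integral (by norm_num : (0 : ℝ) < 3)
  rw [show (3 : ℝ) = (2 : ℕ) + 1 by norm_num, Real.Gamma_nat_eq_factorial] at h
  have e : (fun x : ℝ ↦ Real.exp (-x) * x ^ ((2 : ℕ) + 1 - 1 : ℝ)) = fun x ↦ Real.exp (-x) * x ^ 2 := by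
    funext x; rw [show ((2 : ℕ) + 1 - 1 : ℝ) = (2 : ℕ) by norm_num, Real.rpow_natCast]
  rw [e] at h
  rw [← h]; norm_num [Nat.factorial]

/-- Integrability of `e^{−t} t²` on `(0, ∞)`. [folklore] -/
theorem integrableOn_exp_neg_mul_sq : IntegrableOn (fun t : ℝ ↦ Real.exp (-t) * t ^ 2) (Ioi 0) := by
  have h := Real.GammaIntegral_convergent (by norm_num : (0 : ℝ) < 3)
  refine h.congr_fun (fun x _ ↦ ?_) measurableSet_Ioi
  simp only
  rw [show ((3 : ℝ) - 1) = (2 : ℕ) by norm_num, Real.rpow_natCast]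

/-- **The bound for one Mellin integral of the truncated remainder**:
`‖∫₁^∞ R_z(t) t^{s−1} dt‖ ≤ 24 √y e^{−(7/5)πy}` for `Re s ≤ 2`, `y ≥ 1` (`t^{σ−1} ≤ t` on `t ≥ 1`,
`‖R_z‖ ≤ 12√y e^{−(7/5)πy} t e^{−t}`, `∫₀^∞ t²e^{−t} = 2`). [folklore] -/
theorem norm_mellin_thetaRemainderTop_le (z : ℍ) (hy : 1 ≤ z.im) {s : ℂ} (hs : s.re ≤ 2) :
    ‖mellin (thetaRemainderTop z) s‖ ≤ 24 * Real.sqrt z.im * Real.exp (-(7 / 5) * Real.pi * z.im) := by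
  set C : ℝ := 12 * Real.sqrt z.im * Real.exp (-(7 / 5) * Real.pi * z.im) with hC
  have hC0 : 0 ≤ C := by positivity
  rw [mellin]
  have hbound : ∀ t ∈ Ioi (0 : ℝ), ‖(t : ℂ) ^ (s - 1) • thetaRemainderTop z t‖ ≤ C * (Real.exp (-t) * t ^ 2) := by
    intro t ht
    have ht0 : 0 < t := ht
    rw [norm_smul, Complex.norm_cpow_eq_rpow_re_of_pos ht0, Complex.sub_re, Complex.one_re]
    rcases le_or_gt t 1 with h1 | h1
    · have : thetaRemainderTop z t = 0 := Set.indicator_of_notMem (by simpa using h1) _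
      rw [this, norm_zero, mul_zero]
      positivity
    · have hval : thetaRemainderTop z t = thetaRemainder z t := Set.indicator_of_mem (mem_Ioi.2 h1) _
      rw [hval]
      have hR := norm_thetaRemainder_le_of_one_le z hy h1.le
      have hpow : t ^ (s.re - 1) ≤ t := by
        calc t ^ (s.re - 1) ≤ t ^ (1 : ℝ) := Real.rpow_le_rpow_of_exponent_le h1.le (by linarith)
          _ = t := Real.rpow_one t
      have hE := Real.exp_pos (-t)
      calc t ^ (s.re - 1) * ‖thetaRemainder z t‖ ≤ t * (C * (t * Real.exp (-t))) :=
            mul_le_mul hpow hR (norm_nonneg _) ht0.le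
        _ = C * (Real.exp (-t) * t ^ 2) := by ring
  have hint : Integrable (fun t : ℝ ↦ C * (Real.exp (-t) * t ^ 2)) (volume.restrict (Ioi 0)) :=
    integrableOn_exp_neg_mul_sq.const_mul C
  calc ‖∫ t in Ioi (0 : ℝ), (t : ℂ) ^ (s - 1) • thetaRemainderTop z t‖
      ≤ ∫ t in Ioi (0 : ℝ), C * (Real.exp (-t) * t ^ 2) := by
        refine norm_integral_le_of_norm_le hint ?_
        exact (ae_restrict_iff' measurableSet_Ioi).2 (Eventually.of_forall hbound)
    _ = C * 2 := by rw [integral_const_mul, integral_exp_neg_mul_sq]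
    _ = 24 * Real.sqrt z.im * Real.exp (-(7 / 5) * Real.pi * z.im) := by rw [hC]; ring

/-- **`|E_z(s)| ≤ 48 √y e^{−(7/5)πy}` for `−1 ≤ Re s ≤ 2`, `y ≥ 1`** — the form of Bateman–Grosswald's
Theorem 2 ((8): `|H(s)| < (Γ(σ)/|Γ(s)|){2e^{−2πk}k^{−½} + …}` on `½ ≤ σ ≤ 1`) and of Stark's (15)
(`|h(s)| < 1/k`) that is used here; only the exponential smallness matters. [cite: BatemanGrosswald1964, Theorem 2 (8)] -/
theorem norm_epsteinBesselPart_le (z : ℍ) (hy : 1 ≤ z.im) {s : ℂ} (h1 : -1 ≤ s.re) (h2 : s.re ≤ 2) :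
    ‖epsteinBesselPart z s‖ ≤ 48 * Real.sqrt z.im * Real.exp (-(7 / 5) * Real.pi * z.im) := by
  unfold epsteinBesselPart
  have ha := norm_mellin_thetaRemainderTop_le z hy h2
  have hb := norm_mellin_thetaRemainderTop_le z hy (s := 1 - s) (by simp; linarith)
  calc ‖mellin (thetaRemainderTop z) s + mellin (thetaRemainderTop z) (1 - s)‖
      ≤ ‖mellin (thetaRemainderTop z) s‖ + ‖mellin (thetaRemainderTop z) (1 - s)‖ := norm_add_le _ _
    _ ≤ _ := by linarith

/-! ## The Mellin transform of the remainder equals `E_z` -/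

/-- Congruence of `HasMellin` along functions agreeing on `(0, ∞)`. [folklore] -/
theorem hasMellin_congr_Ioi {f g : ℝ → ℂ} {s L : ℂ} (h : EqOn f g (Ioi 0)) (hf : HasMellin f s L) :
    HasMellin g s L := by
  have he : EqOn (fun t : ℝ ↦ (t : ℂ) ^ (s - 1) • f t) (fun t ↦ (t : ℂ) ^ (s - 1) • g t) (Ioi 0) :=
    fun t ht ↦ by simp only [h ht]
  refine ⟨hf.1.congr_fun he measurableSet_Ioi, ?_⟩
  rw [mellin, ← setIntegral_congr_fun measurableSet_Ioi he]
  exact hf.2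

/-- Congruence of `MellinConvergent` along functions agreeing on `(0, ∞)`. [folklore] -/
theorem mellinConvergent_congr_Ioi {f g : ℝ → ℂ} {s : ℂ} (h : EqOn f g (Ioi 0))
    (hf : MellinConvergent f s) : MellinConvergent g s :=
  hf.congr_fun (fun t ht ↦ by simp only [h ht]) measurableSet_Ioi

/-- `MellinConvergent` is closed under subtraction. [folklore] -/
theorem mellinConvergent_sub {f g : ℝ → ℂ} {s : ℂ} (hf : MellinConvergent f s)
    (hg : MellinConvergent g s) : MellinConvergent (fun t ↦ f t - g t) s :=
  (hf.sub hg).congr_fun (fun t _ ↦ by simp only [Pi.sub_apply, smul_sub]) measurableSet_Ioi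

/-- **Riemann's trick**: whenever `∫₀^∞ R_z t^{s−1}` converges absolutely, it equals
`E_z(s) = ∫₁^∞ (t^{s−1} + t^{−s}) R_z` (split at `1` and substitute `t ↦ 1/t` on `(0, 1)` using
`R_z(1/t) = tR_z(t)`). [folklore] -/
theorem mellin_thetaRemainder_eq (z : ℍ) (hy : 1 ≤ z.im) {s : ℂ}
    (hconv : MellinConvergent (thetaRemainder z) s) :
    mellin (thetaRemainder z) s = epsteinBesselPart z s := by
  set T := thetaRemainderTop z with hT
  set Bot : ℝ → ℂ := (Ioc 0 1).indicator (thetaRemainder z) with hBot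
  have hsplit : EqOn (thetaRemainder z) (fun t ↦ T t + Bot t) (Ioi 0) := by
    intro t ht
    simp only [hT, hBot, thetaRemainderTop]
    rcases le_or_gt t 1 with h1 | h1
    · rw [Set.indicator_of_notMem (by simpa using h1), Set.indicator_of_mem (by exact ⟨ht, h1⟩), zero_add]
    · rw [Set.indicator_of_mem (mem_Ioi.2 h1), Set.indicator_of_notMem (by simp [not_le.2 h1]), add_zero]
  have hTc : MellinConvergent T s := mellinConvergent_thetaRemainderTop z hy s
  have hBc : MellinConvergent Bot s := by
    have h := mellinConvergent_sub hconv hTc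
    refine mellinConvergent_congr_Ioi (fun t ht ↦ ?_) h
    simp only [hsplit ht, add_sub_cancel_left]
  -- `mellin R = mellin T + mellin Bot`
  have hsum : mellin (thetaRemainder z) s = mellin T s + mellin Bot s := by
    have h := hasMellin_add hTc hBc
    exact (hasMellin_congr_Ioi (fun t ht ↦ (hsplit ht).symm) h).2
  -- `mellin Bot s = mellin T (1 - s)`
  have hBot_eq : mellin Bot s = mellin T (1 - s) := by
    have h1 : mellin (fun t : ℝ ↦ (t : ℂ) ^ (-1 : ℂ) • T t⁻¹) s = mellin T (1 - s) := by
      rw [mellin_cpow_smul (fun t : ℝ ↦ T t⁻¹) s (-1), mellin_comp_inv]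
      congr 1; ring
    rw [← h1, mellin, mellin]
    refine integral_congr_ae ?_
    have hne : ∀ᵐ t : ℝ, t ≠ 1 := by rw [ae_iff]; simp
    refine (ae_restrict_iff' measurableSet_Ioi).2 ?_
    filter_upwards [hne] with t ht1 ht
    have ht0 : 0 < t := ht
    simp only [hBot, hT, thetaRemainderTop]
    rcases lt_or_gt_of_ne ht1 with h | h
    · -- `0 < t < 1`: `Bot t = R t = t⁻¹ R(t⁻¹) = t⁻¹ T(t⁻¹)`
      have hinv : 1 < t⁻¹ := one_lt_inv_iff₀.2 ⟨ht0, h⟩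
      rw [Set.indicator_of_mem (show t ∈ Ioc (0 : ℝ) 1 from ⟨ht0, h.le⟩),
        Set.indicator_of_mem (mem_Ioi.2 hinv), thetaRemainder_inv z ht0]
      have htc : (t : ℂ) ≠ 0 := by exact_mod_cast ht0.ne'
      simp only [Complex.cpow_neg_one, smul_eq_mul]
      field_simp
    · -- `t > 1`: both vanish
      have hinv : t⁻¹ < 1 := inv_lt_one_of_one_lt₀ h
      rw [Set.indicator_of_notMem (by simp [not_le.2 h]),
        Set.indicator_of_notMem (by simpa using hinv.le)]
      simp only [smul_zero]
  rw [hsum, hBot_eq, epsteinBesselPart]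

/-! ## The two constant terms: Mellin transforms of `ϑ(t/y) − 1` and `√(y/t)(ϑ(yt) − 1)` -/

/-- Mathlib's Hurwitz pair at `a = 0`: `Λ^H(s) = 2 Λ(2s)` (`Λ = completedRiemannZeta`). [folklore] -/
theorem hurwitzEvenFEPair_zero_Λ (s : ℂ) :
    (hurwitzEvenFEPair 0).Λ s = 2 * completedRiemannZeta (2 * s) := by
  have e : completedRiemannZeta (2 * s) = (hurwitzEvenFEPair 0).Λ (2 * s / 2) / 2 := rfl
  rw [e, mul_div_cancel_left₀ s two_ne_zero]
  ring

/-- **`∫₀^∞ (ϑ(t) − 1) t^{s−1} dt = 2Λ(2s)` for `Re s > ½`** (Mathlib's `WeakFEPair.hasMellin` for the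
Hurwitz pair). [folklore] -/
theorem hasMellin_evenKernel_sub_one {s : ℂ} (hs : 1 / 2 < s.re) :
    HasMellin (fun t : ℝ ↦ ((evenKernel 0 t : ℝ) : ℂ) - 1) s (2 * completedRiemannZeta (2 * s)) := by
  have h := (hurwitzEvenFEPair 0).hasMellin (s := s) (by show (1 : ℝ) / 2 < s.re; exact hs)
  rw [hurwitzEvenFEPair_zero_Λ] at h
  have e : (fun x : ℝ ↦ (hurwitzEvenFEPair 0).f x - (hurwitzEvenFEPair 0).f₀) =
      fun t : ℝ ↦ ((evenKernel 0 t : ℝ) : ℂ) - 1 := by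
    funext t
    simp [hurwitzEvenFEPair]
  rw [e] at h
  exact h

/-- For `y > 0`: `((y⁻¹ : ℝ) : ℂ)^{−s} = y^s`. [folklore] -/
theorem ofReal_inv_cpow_neg {y : ℝ} (hy : 0 < y) (s : ℂ) :
    (((y⁻¹ : ℝ)) : ℂ) ^ (-s) = ((y : ℝ) : ℂ) ^ s := by
  rw [Complex.ofReal_inv, Complex.inv_cpow _ _ (by
    rw [Complex.arg_ofReal_of_nonneg hy.le]; exact Real.pi_ne_zero.symm), Complex.cpow_neg, inv_inv]

/-- **First constant term**: `∫₀^∞ (ϑ(t/y) − 1) t^{s−1} dt = y^s · 2Λ(2s)` (`Re s > ½`).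
[cite: BatemanGrosswald1964, §3 (15)–(17)] -/
theorem hasMellin_constantTerm_fst (z : ℍ) {s : ℂ} (hs : 1 / 2 < s.re) :
    HasMellin (fun t : ℝ ↦ ((evenKernel 0 (t / z.im) : ℝ) : ℂ) - 1) s
      (((z.im : ℝ) : ℂ) ^ s * (2 * completedRiemannZeta (2 * s))) := by
  have hy := z.im_pos
  have h := hasMellin_evenKernel_sub_one hs
  set F : ℝ → ℂ := fun t ↦ ((evenKernel 0 t : ℝ) : ℂ) - 1 with hF
  have e : (fun t : ℝ ↦ ((evenKernel 0 (t / z.im) : ℝ) : ℂ) - 1) = fun t ↦ F (z.im⁻¹ * t) := by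
    funext t; simp only [hF, div_eq_inv_mul]
  rw [e]
  refine ⟨(MellinConvergent.comp_mul_left (inv_pos.2 hy)).2 h.1, ?_⟩
  rw [mellin_comp_mul_left F s (inv_pos.2 hy), h.2, ofReal_inv_cpow_neg hy, smul_eq_mul]

/-- **Second constant term**: `∫₀^∞ √(y/t)(ϑ(yt) − 1) t^{s−1} dt = y^{1−s} · 2Λ(2s − 1)` (`Re s > 1`).
[cite: BatemanGrosswald1964, §3 (15)–(17)] -/
theorem hasMellin_constantTerm_snd (z : ℍ) {s : ℂ} (hs : 1 < s.re) :
    HasMellin (fun t : ℝ ↦ (Real.sqrt (z.im / t) : ℂ) * (((evenKernel 0 (z.im * t) : ℝ) : ℂ) - 1)) s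
      (((z.im : ℝ) : ℂ) ^ (1 - s) * (2 * completedRiemannZeta (2 * s - 1))) := by
  have hy := z.im_pos
  set y : ℝ := z.im with hydef
  set F : ℝ → ℂ := fun t ↦ ((evenKernel 0 t : ℝ) : ℂ) - 1 with hF
  set G : ℝ → ℂ := fun t ↦ F (y * t) with hG
  -- `G` : Mellin at `s - 1/2`
  have hs' : 1 / 2 < (s - 1 / 2).re := by simp; linarith
  have hFm := hasMellin_evenKernel_sub_one hs'
  have hGc : MellinConvergent G (s - 1 / 2) := (MellinConvergent.comp_mul_left hy).2 hFm.1
  have hGv : mellin G (s - 1 / 2) = ((y : ℝ) : ℂ) ^ (-(s - 1 / 2)) * (2 * completedRiemannZeta (2 * s - 1)) := by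
    rw [hG, mellin_comp_mul_left F (s - 1 / 2) hy, hFm.2, smul_eq_mul]
    congr 2; ring
  -- the function in the form `t^{-1/2} • (√y G t)`
  set H : ℝ → ℂ := fun t ↦ (t : ℂ) ^ (-(1 / 2 : ℂ)) • ((Real.sqrt y : ℂ) • G t) with hH
  have heq : EqOn H (fun t : ℝ ↦ (Real.sqrt (y / t) : ℂ) * (((evenKernel 0 (y * t) : ℝ) : ℂ) - 1))
      (Ioi 0) := by
    intro t ht
    have ht0 : 0 < t := ht
    have e1 : (Real.sqrt (y / t) : ℂ) = (t : ℂ) ^ (-(1 / 2 : ℂ)) * Real.sqrt y := by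
      rw [Real.sqrt_div' _ ht0.le, Complex.ofReal_div, div_eq_mul_inv, mul_comm, ← Complex.ofReal_inv,
        inv_sqrt_eq_rpow ht0.le, Complex.ofReal_cpow ht0.le]
      push_cast
      ring_nf
    simp only [hH, hG, hF, smul_eq_mul]
    rw [e1]
    ring
  have hHc : MellinConvergent H s := by
    rw [hH, MellinConvergent.cpow_smul, show s + -(1 / 2 : ℂ) = s - 1 / 2 by ring]
    exact hGc.const_smul _
  have hHv : mellin H s = ((y : ℝ) : ℂ) ^ (1 - s) * (2 * completedRiemannZeta (2 * s - 1)) := by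
    rw [hH, mellin_cpow_smul, show s + -(1 / 2 : ℂ) = s - 1 / 2 by ring, mellin_const_smul, hGv,
      smul_eq_mul, ← mul_assoc]
    congr 1
    -- `√y · y^{-(s - 1/2)} = y^{1-s}`
    have hyc : ((y : ℝ) : ℂ) ≠ 0 := by exact_mod_cast hy.ne'
    rw [Real.sqrt_eq_rpow, Complex.ofReal_cpow hy.le, ← Complex.cpow_add _ _ hyc]
    congr 1; push_cast; ring
  exact hasMellin_congr_Ioi heq ⟨hHc, hHv⟩

/-! ## The decomposition of `Λ_z` -/

/-- **`Λ_z(s) = 2y^sΛ(2s) + 2y^{1−s}Λ(2 − 2s) + E_z(s)` for `Re s > 1`** (termwise Mellin transform of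
`Θ_z − 1 = [ϑ(t/y) − 1] + √(y/t)[ϑ(yt) − 1] + R_z`; Bateman–Grosswald (3)–(5) ×`2(k/π)^sΓ(s)`,
Stark's `α = f(s) + f(1−s) + g(s)` ×2). [cite: BatemanGrosswald1964, Theorem 1 (3)–(5)] -/
theorem Λ_eq_constantTerm_add_besselPart_of_one_lt (z : ℍ) (hy : 1 ≤ z.im) {s : ℂ} (hs : 1 < s.re) :
    (thetaFEPair z).Λ s = 2 * ((z.im : ℝ) : ℂ) ^ s * completedRiemannZeta (2 * s) +
      2 * ((z.im : ℝ) : ℂ) ^ (1 - s) * completedRiemannZeta (2 - 2 * s) + epsteinBesselPart z s := by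
  have hθ : HasMellin (fun t : ℝ ↦ ((thetaQ z t : ℝ) : ℂ) - 1) s ((thetaFEPair z).Λ s) :=
    (thetaFEPair z).hasMellin (show (1 : ℝ) < s.re from hs)
  have h₁ := hasMellin_constantTerm_fst z (by linarith : 1 / 2 < s.re)
  have h₂ := hasMellin_constantTerm_snd z hs
  -- `R = (Θ − 1) − X₁ − X₂`
  have hR : (thetaRemainder z) = fun t ↦ ((((thetaQ z t : ℝ) : ℂ) - 1) -
      ((((evenKernel 0 (t / z.im) : ℝ) : ℂ) - 1))) -
      (Real.sqrt (z.im / t) : ℂ) * (((evenKernel 0 (z.im * t) : ℝ) : ℂ) - 1) := by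
    funext t; rw [thetaRemainder_def]; ring
  have hRm : HasMellin (thetaRemainder z) s ((thetaFEPair z).Λ s -
      ((z.im : ℝ) : ℂ) ^ s * (2 * completedRiemannZeta (2 * s)) -
      ((z.im : ℝ) : ℂ) ^ (1 - s) * (2 * completedRiemannZeta (2 * s - 1))) := by
    rw [hR]
    have h12 := hasMellin_sub (hasMellin_sub hθ.1 h₁.1).1 h₂.1
    rw [(hasMellin_sub hθ.1 h₁.1).2, hθ.2, h₁.2, h₂.2] at h12
    exact h12
  have hE := mellin_thetaRemainder_eq z hy hRm.1
  rw [hRm.2] at hE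
  have hfe : completedRiemannZeta (2 * s - 1) = completedRiemannZeta (2 - 2 * s) := by
    rw [← completedRiemannZeta_one_sub (2 * s - 1)]; congr 1; ring
  rw [hfe] at hE
  linear_combination hE

/-- `ℂ ∖ {0, ½, 1}` is preconnected. [folklore] -/
theorem isPreconnected_compl_zero_half_one :
    IsPreconnected {s : ℂ | s ≠ 0 ∧ s ≠ 1 ∧ s ≠ 1 / 2} := by
  have e : {s : ℂ | s ≠ 0 ∧ s ≠ 1 ∧ s ≠ 1 / 2} = ({0, 1, 1 / 2} : Set ℂ)ᶜ := by
    ext s; simp [not_or]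
  rw [e]
  refine (Set.Countable.isConnected_compl_of_one_lt_rank ?_ (Set.toFinite _).countable).isPreconnected
  rw [Complex.rank_real_complex]
  exact Cardinal.one_lt_two

/-- **The constant-term decomposition of the completed Epstein zeta function, everywhere**:
for `s ∉ {0, ½, 1}` and `y = Im z ≥ 1`,
`Λ_z(s) = 2y^sΛ(2s) + 2y^{1−s}Λ(2 − 2s) + E_z(s)` with `E_z` entire, `E_z(1−s) = E_z(s)`,
`|E_z(σ+it)| ≤ 48√y e^{−1.4πy}` (`−1 ≤ σ ≤ 2`) (identity theorem from `Re s > 1`). This is the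
Mellin-side form of Bateman–Grosswald's Theorem 1 ((3): `a^sZ(s) = ζ(2s) + k^{1−2s}ζ(2s−1)Γ(s−½)√π/Γ(s)
+ π^sΓ(s)⁻¹k^{½−s}H(s)`, multiplied by `2(k/π)^sΓ(s)`, `k = y`), with `E_z` in the role of `2k^{½}H`
(not identified with `bgH` here; see `Literature.Barriers.RiemannHypothesis.chowlaSelberg_formula` for the
`K`-Bessel form). [cite: BatemanGrosswald1964, Theorem 1 (3)–(5)] -/
theorem Λ_eq_constantTerm_add_besselPart (z : ℍ) (hy : 1 ≤ z.im) {s : ℂ} (h0 : s ≠ 0) (h1 : s ≠ 1)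
    (hh : s ≠ 1 / 2) :
    (thetaFEPair z).Λ s = 2 * ((z.im : ℝ) : ℂ) ^ s * completedRiemannZeta (2 * s) +
      2 * ((z.im : ℝ) : ℂ) ^ (1 - s) * completedRiemannZeta (2 - 2 * s) + epsteinBesselPart z s := by
  have hy0 : 0 < z.im := z.im_pos
  have hyc : ((z.im : ℝ) : ℂ) ≠ 0 := by exact_mod_cast hy0.ne'
  set U : Set ℂ := {s : ℂ | s ≠ 0 ∧ s ≠ 1 ∧ s ≠ 1 / 2} with hU
  have hUo : IsOpen U := (isOpen_ne.inter (isOpen_ne.inter isOpen_ne))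
  set G : ℂ → ℂ := fun s ↦ 2 * ((z.im : ℝ) : ℂ) ^ s * completedRiemannZeta (2 * s) +
      2 * ((z.im : ℝ) : ℂ) ^ (1 - s) * completedRiemannZeta (2 - 2 * s) + epsteinBesselPart z s with hG
  -- analyticity of both sides on `U`
  have hF : AnalyticOnNhd ℂ (thetaFEPair z).Λ U := by
    apply DifferentiableOn.analyticOnNhd _ hUo
    intro w hw
    refine ((thetaFEPair z).differentiableAt_Λ (Or.inl hw.1) (Or.inl ?_)).differentiableWithinAt
    simpa [thetaFEPair] using hw.2.1
  have hGa : AnalyticOnNhd ℂ G U := by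
    apply DifferentiableOn.analyticOnNhd _ hUo
    intro w hw
    apply DifferentiableAt.differentiableWithinAt
    have hw2 : 2 * w ≠ 0 := mul_ne_zero two_ne_zero hw.1
    have hw2' : 2 * w ≠ 1 := fun h ↦ hw.2.2 (by linear_combination h / 2)
    have hw3 : 2 - 2 * w ≠ 0 := fun h ↦ hw.2.1 (by linear_combination -h / 2)
    have hw3' : 2 - 2 * w ≠ 1 := fun h ↦ hw.2.2 (by linear_combination -h / 2)
    have d1 : DifferentiableAt ℂ (fun s : ℂ ↦ ((z.im : ℝ) : ℂ) ^ s) w :=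
      differentiableAt_id.const_cpow (Or.inl hyc)
    have d2 : DifferentiableAt ℂ (fun s : ℂ ↦ ((z.im : ℝ) : ℂ) ^ (1 - s)) w :=
      (differentiableAt_const _ |>.sub differentiableAt_id).const_cpow (Or.inl hyc)
    have d3 : DifferentiableAt ℂ (fun s : ℂ ↦ completedRiemannZeta (2 * s)) w :=
      (differentiableAt_completedZeta hw2 hw2').comp w (differentiableAt_id.const_mul _)
    have d4 : DifferentiableAt ℂ (fun s : ℂ ↦ completedRiemannZeta (2 - 2 * s)) w :=
      (differentiableAt_completedZeta hw3 hw3').comp w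
        ((differentiableAt_const _).sub (differentiableAt_id.const_mul _))
    have d5 : DifferentiableAt ℂ (epsteinBesselPart z) w := differentiable_epsteinBesselPart z hy w
    exact ((((differentiableAt_const _).mul d1).mul d3).add (((differentiableAt_const _).mul d2).mul d4)).add d5
  -- agreement near `s₀ = 2`
  have h2U : (2 : ℂ) ∈ U := by
    refine ⟨two_ne_zero, by norm_num, by norm_num⟩
  have hev : (thetaFEPair z).Λ =ᶠ[𝓝 (2 : ℂ)] G := by
    have hopen : IsOpen {s : ℂ | 1 < s.re} := isOpen_lt continuous_const Complex.continuous_re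
    filter_upwards [hopen.mem_nhds (show (2 : ℂ) ∈ {s : ℂ | 1 < s.re} by simp)] with w hw
    exact Λ_eq_constantTerm_add_besselPart_of_one_lt z hy hw
  have heq := hF.eqOn_of_preconnected_of_eventuallyEq hGa isPreconnected_compl_zero_half_one h2U hev
  exact heq ⟨h0, h1, hh⟩

end Literature.Barriers.RiemannHypothesis
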